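import Mathlib
import HarnessLib
import Literature.Analysis.FluidPDE.KNSSMildRegularityTime
import Literature.Analysis.FluidPDE.HeatFlowGigaL5
import Literature.Analysis.UnboundedOperators.HeatExtensionHarnack
import Summits.NavierStokesRegularity.NavierStokesRegularity.Theorems.PoloidalWindowDoorPoloidalWindowRigidityOseenBumpPairing

/-!
# Route `PoloidalWindowDoor`, crux `PoloidalWindowRigidity` (K2, stmt-NavierStokesRegularity-19708) —
# RATES FOR A SCALAR BUMP: the `y`-integrated kernel bounds, the two time rates, and the caloric datum defect

Cell ns-regularity-ideate, seat nsreg-p7 (gen 6, third worker under the K2 lead; `--supports stmt-…-19708`).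
Second kernel-side brick of the discharge of the K2 lead's hypothesis (F1) (`…LargeScaleEnergy`, `hBMO`),
feeding the LARGE-SCALE MOMENTUM CONSERVATION of the Type-I mild class (`…LargeScaleMomentum`). Everything is
stated with Lebesgue integrals in `ℝ≥0∞` (so that Tonelli needs no integrability bookkeeping):

* `lintegral_ofReal_conv_eq` — `∫⁻_y ∫ k(x − y) g(x) dx = ‖k‖₁ ‖g‖₁` for nonnegative continuous `k`,
  `g ∈ C_c`;
* `heatRate`, `nearRate`, `farRate` — the `y`-integrals of the three majorants of `…OseenBumpPairing`:
  `≤ ‖Dθ‖₁`, `≤ 2^{3/2}s^{-1/2}‖D²θ‖₁` (tree `lintegral_enorm_fderiv_heatKernel_le`), `≤ K_Θ (s^{-1/2})³ ‖θ‖₁`;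
* `lintegral_Ioc_rate`, `lintegral_Ioi_rate` — `∫₀^{R²} s^{-1/2} ds = 2R`, `∫_{R²}^∞ (s^{-1/2})³ ds = 2/R`;
* `measurable_nearIntegrand`, `measurable_farIntegrand` — joint measurability in `(s, y)` of the two
  parametric majorants (explicit Gaussian formulas, `measurable_heatKernel_uncurry`);
* `lintegral_enorm_heatExtension_sub_self_le` — the CALORIC DATUM DEFECT of a test function:
  `∫ |e^{σΔ}θ − θ| ≤ σ ∫|Δθ|` (tree `KNSSBootstrap.heatExtension_sub_self_eq_integral` + `L¹`-contraction).

WHAT THIS IS NOT: not a claim about Navier–Stokes regularity and not the open residue S2⁗ — Gaussian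
bookkeeping (bears_on LADDER-NS N0 via crux K2 = stmt-19708; whole-class tool).
-/

noncomputable section

-- the summit and its single sub-problem share the name (CONVENTIONS §1), as in every Theorems file
set_option linter.dupNamespace false
-- nested operator types `ℝ³ →L[ℝ] ℝ³ →L[ℝ] ℝ`
set_option maxSynthPendingDepth 3

namespace Summit.NavierStokesRegularity.NavierStokesRegularity.Theorems.PoloidalWindowDoorPoloidalWindowRigidityBumpRates

open MeasureTheory Set Function Filter Topology Metric InnerProductSpace
open scoped RealInnerProductSpace ENNReal NNReal Laplacian ContDiff
open Literature.Analysis Literature.Analysis.FluidPDE Literature.Analysis.UnboundedOperators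
open Summit.NavierStokesRegularity.NavierStokesRegularity.Theorems.PoloidalWindowDoorPoloidalWindowRigidityOseenBumpPairing

/-! ## Tonelli for translated kernels -/

/-- **`∫⁻_y (∫ k(x − y) g(x) dx) = ‖k‖₁ · ‖g‖₁`** for a nonnegative continuous kernel `k` and a
nonnegative continuous compactly supported `g` (Tonelli and translation invariance). [folklore] -/
theorem lintegral_ofReal_conv_eq {k g : EuclideanSpace ℝ (Fin 3) → ℝ} (hk : Continuous k) (hk0 : ∀ z, 0 ≤ k z)
    (hg : Continuous g) (hg0 : ∀ x, 0 ≤ g x) (hgc : HasCompactSupport g) :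
    ∫⁻ y, ENNReal.ofReal (∫ x, k (x - y) * g x) =
      (∫⁻ z, ENNReal.ofReal (k z)) * ∫⁻ x, ENNReal.ofReal (g x) := by
  -- the inner real integral is a Lebesgue integral
  have hint : ∀ y, Integrable (fun x => k (x - y) * g x) volume := fun y =>
    ((hk.comp (continuous_id.sub continuous_const)).mul hg).integrable_of_hasCompactSupport hgc.mul_left
  have h1 : ∀ y, ENNReal.ofReal (∫ x, k (x - y) * g x) =
      ∫⁻ x, ENNReal.ofReal (k (x - y)) * ENNReal.ofReal (g x) := by
    intro y
    rw [ofReal_integral_eq_lintegral_ofReal (hint y)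
      (Eventually.of_forall fun x => mul_nonneg (hk0 _) (hg0 _))]
    refine lintegral_congr fun x => ?_
    rw [ENNReal.ofReal_mul (hk0 _)]
  simp_rw [h1]
  -- Tonelli
  have hmeas : AEMeasurable (uncurry fun (y x : EuclideanSpace ℝ (Fin 3)) =>
      ENNReal.ofReal (k (x - y)) * ENNReal.ofReal (g x)) ((volume : Measure (EuclideanSpace ℝ (Fin 3))).prod volume) := by
    have h : Continuous fun p : EuclideanSpace ℝ (Fin 3) × EuclideanSpace ℝ (Fin 3) => k (p.2 - p.1) :=
      hk.comp (continuous_snd.sub continuous_fst)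
    exact ((h.measurable.ennreal_ofReal).mul ((hg.comp continuous_snd).measurable.ennreal_ofReal)).aemeasurable
  rw [lintegral_lintegral_swap hmeas]
  have h2 : ∀ x, ∫⁻ y, ENNReal.ofReal (k (x - y)) * ENNReal.ofReal (g x) =
      (∫⁻ z, ENNReal.ofReal (k z)) * ENNReal.ofReal (g x) := by
    intro x
    have hkm : Measurable fun y : EuclideanSpace ℝ (Fin 3) => ENNReal.ofReal (k (x - y)) :=
      (hk.comp (continuous_const.sub continuous_id :
        Continuous fun y : EuclideanSpace ℝ (Fin 3) => x - y)).measurable.ennreal_ofReal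
    rw [lintegral_mul_const _ hkm, lintegral_sub_left_eq_self (fun z => ENNReal.ofReal (k z)) x]
  simp_rw [h2]
  rw [lintegral_const_mul _ (hg.measurable.ennreal_ofReal)]

/-! ## The three `y`-integrated rates -/

section Rates

variable {θ : EuclideanSpace ℝ (Fin 3) → ℝ}

/-- **Heat rate:** `∫⁻_y ∫ G_σ(x − y) ‖Dθ(x)‖ dx ≤ ‖Dθ‖₁` (`∫ G_σ = 1`). [folklore] -/
theorem heatRate (hθ : FunctionSpaces.IsTestFunctionOn (⊤ : TopologicalSpace.Opens (EuclideanSpace ℝ (Fin 3))) θ)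
    {σ : ℝ} (hσ : 0 < σ) :
    ∫⁻ y, ENNReal.ofReal (∫ x, heatKernel σ (x - y) * ‖fderiv ℝ θ x‖) ≤
      ∫⁻ x, ENNReal.ofReal ‖fderiv ℝ θ x‖ := by
  have hθ1 : ContDiff ℝ 1 θ := contDiff_infty.1 hθ.contDiff 1
  rw [lintegral_ofReal_conv_eq (continuous_heatKernel σ) (fun z => (heatKernel_pos hσ z).le)
    (hθ1.continuous_fderiv one_ne_zero).norm (fun x => norm_nonneg _) (hθ.hasCompactSupport.fderiv (𝕜 := ℝ)).norm]
  have h1 : ∫⁻ z : EuclideanSpace ℝ (Fin 3), ENNReal.ofReal (heatKernel σ z) = 1 := by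
    rw [← ofReal_integral_eq_lintegral_ofReal (integrable_heatKernel_holds hσ)
      (Eventually.of_forall fun z => (heatKernel_pos hσ z).le), integral_heatKernel_eq_one_holds hσ,
      ENNReal.ofReal_one]
  rw [h1, one_mul]

/-- **Near rate:** `∫⁻_y ∫ ‖DG_s(x − y)‖ ‖D²θ(x)‖ dx ≤ 2^{3/2} s^{-1/2} ‖D²θ‖₁`. [folklore] -/
theorem nearRate (hθ : FunctionSpaces.IsTestFunctionOn (⊤ : TopologicalSpace.Opens (EuclideanSpace ℝ (Fin 3))) θ)
    {s : ℝ} (hs : 0 < s) :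
    ∫⁻ y, ENNReal.ofReal (∫ x, ‖fderiv ℝ (heatKernel s) (x - y)‖ * ‖fderiv ℝ (fderiv ℝ θ) x‖) ≤
      ENNReal.ofReal ((2 : ℝ) ^ ((Module.finrank ℝ (EuclideanSpace ℝ (Fin 3)) : ℝ) / 2) * s ^ (-(1 / 2 : ℝ))) *
        ∫⁻ x, ENNReal.ofReal ‖fderiv ℝ (fderiv ℝ θ) x‖ := by
  have hθ2 : ContDiff ℝ 2 θ := contDiff_infty.1 hθ.contDiff 2
  have hD2c : Continuous (fderiv ℝ (fderiv ℝ θ)) :=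
    (hθ2.fderiv_right (m := 1) le_rfl).continuous_fderiv one_ne_zero
  have hD2s : HasCompactSupport (fderiv ℝ (fderiv ℝ θ)) := (hθ.hasCompactSupport.fderiv (𝕜 := ℝ)).fderiv (𝕜 := ℝ)
  rw [lintegral_ofReal_conv_eq (continuous_fderiv_heatKernel s).norm (fun z => norm_nonneg _)
    hD2c.norm (fun x => norm_nonneg _) hD2s.norm]
  gcongr
  calc ∫⁻ z, ENNReal.ofReal ‖fderiv ℝ (heatKernel s) z‖ = ∫⁻ z, ‖fderiv ℝ (heatKernel s) z‖ₑ :=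
        lintegral_congr fun z => ofReal_norm _
    _ ≤ _ := lintegral_enorm_fderiv_heatKernel_le hs

/-- **Far rate:** `∫⁻_y ∫ m_s(x − y) |θ(x)| dx ≤ K_Θ (s^{-1/2})³ ‖θ‖₁`, with the majorant and constant of
`…OseenBumpPairing.integrable_majorant_and_integral_le`. [folklore] -/
theorem farRate (hθ : FunctionSpaces.IsTestFunctionOn (⊤ : TopologicalSpace.Opens (EuclideanSpace ℝ (Fin 3))) θ)
    {s : ℝ} (hs : 0 < s) :
    ∫⁻ y, ENNReal.ofReal (∫ x,
        (3 * (heatKernel s (x - y) / (4 * s ^ 2)) * ‖x - y‖ + heatKernel s (x - y) / (8 * s ^ 3) * ‖x - y‖ ^ 3) *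
          |θ x|) ≤
      ENNReal.ofReal (((3 / 2) * (2 : ℝ) ^ ((Module.finrank ℝ (EuclideanSpace ℝ (Fin 3)) : ℝ) / 2) +
          8 * 64 * ((2 : ℝ) ^ ((Module.finrank ℝ (EuclideanSpace ℝ (Fin 3)) : ℝ) / 2)) ^ 3) *
          (s ^ (-(1 / 2 : ℝ))) ^ 3) *
        ∫⁻ x, ENNReal.ofReal |θ x| := by
  obtain ⟨hmi, hmle⟩ := integrable_majorant_and_integral_le hs
  have hθa : Continuous fun x => |θ x| := continuous_abs.comp hθ.contDiff.continuous
  have hθas : HasCompactSupport fun x => |θ x| := hθ.hasCompactSupport.norm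
  rw [lintegral_ofReal_conv_eq (continuous_majorant s) (majorant_nonneg hs) hθa (fun x => abs_nonneg _) hθas]
  gcongr
  rw [← ofReal_integral_eq_lintegral_ofReal hmi (Eventually.of_forall (majorant_nonneg hs))]
  exact ENNReal.ofReal_le_ofReal hmle

end Rates

/-! ## The two time rates -/

/-- `∫₀^{R²} s^{-1/2} ds = 2R` (as a Lebesgue integral of `ofReal`). [folklore] -/
theorem lintegral_Ioc_rate {R : ℝ} (hR : 0 < R) (c : ℝ) (hc : 0 ≤ c) :
    ∫⁻ s in Ioc (0 : ℝ) (R ^ 2), ENNReal.ofReal (c * s ^ (-(1 / 2 : ℝ))) = ENNReal.ofReal (c * (2 * R)) := by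
  have hR2 : 0 ≤ R ^ 2 := sq_nonneg R
  have hii : IntervalIntegrable (fun s : ℝ => s ^ (-(1 / 2 : ℝ))) volume 0 (R ^ 2) :=
    intervalIntegral.intervalIntegrable_rpow' (by norm_num)
  have hint : IntegrableOn (fun s : ℝ => c * s ^ (-(1 / 2 : ℝ))) (Ioc 0 (R ^ 2)) volume :=
    ((intervalIntegrable_iff_integrableOn_Ioc_of_le hR2).1 hii).const_mul c
  have hnn : 0 ≤ᵐ[volume.restrict (Ioc (0 : ℝ) (R ^ 2))] fun s => c * s ^ (-(1 / 2 : ℝ)) := by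
    filter_upwards [ae_restrict_mem measurableSet_Ioc] with s hs
    exact mul_nonneg hc (Real.rpow_nonneg hs.1.le _)
  rw [← ofReal_integral_eq_lintegral_ofReal hint hnn, integral_const_mul,
    ← intervalIntegral.integral_of_le hR2, integral_rpow (Or.inl (by norm_num))]
  congr 1
  have h1 : (R ^ 2) ^ (-(1 / 2 : ℝ) + 1) = R := by
    rw [show (-(1 / 2 : ℝ) + 1) = (1 / 2 : ℝ) by norm_num, ← Real.sqrt_eq_rpow, Real.sqrt_sq hR.le]
  rw [h1, Real.zero_rpow (by norm_num)]
  ring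

/-- `∫_{R²}^∞ (s^{-1/2})³ ds = 2/R` (as a Lebesgue integral of `ofReal`). [folklore] -/
theorem lintegral_Ioi_rate {R : ℝ} (hR : 0 < R) (c : ℝ) (hc : 0 ≤ c) :
    ∫⁻ s in Ioi (R ^ 2), ENNReal.ofReal (c * (s ^ (-(1 / 2 : ℝ))) ^ 3) = ENNReal.ofReal (c * (2 / R)) := by
  have hR2 : 0 < R ^ 2 := by positivity
  have hpow : ∀ s ∈ Ioi (R ^ 2), (s ^ (-(1 / 2 : ℝ))) ^ 3 = s ^ (-(3 / 2 : ℝ)) := by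
    intro s hs
    have hs0 : 0 ≤ s := (hR2.trans hs).le
    rw [← Real.rpow_natCast, ← Real.rpow_mul hs0]
    norm_num
  have hint0 : IntegrableOn (fun s : ℝ => s ^ (-(3 / 2 : ℝ))) (Ioi (R ^ 2)) volume :=
    integrableOn_Ioi_rpow_of_lt (by norm_num) hR2
  have hint : IntegrableOn (fun s : ℝ => c * (s ^ (-(1 / 2 : ℝ))) ^ 3) (Ioi (R ^ 2)) volume := by
    refine IntegrableOn.congr_fun (hint0.const_mul c : IntegrableOn (fun s : ℝ => c * s ^ (-(3 / 2 : ℝ)))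
      (Ioi (R ^ 2)) volume) (fun s hs => ?_) measurableSet_Ioi
    simp only [hpow s hs]
  have hnn : 0 ≤ᵐ[volume.restrict (Ioi (R ^ 2))] fun s : ℝ => c * (s ^ (-(1 / 2 : ℝ))) ^ 3 := by
    filter_upwards [ae_restrict_mem measurableSet_Ioi] with s hs
    exact mul_nonneg hc (pow_nonneg (Real.rpow_nonneg (hR2.trans hs).le _) 3)
  rw [← ofReal_integral_eq_lintegral_ofReal hint hnn, integral_const_mul,
    setIntegral_congr_fun measurableSet_Ioi hpow, integral_Ioi_rpow_of_lt (by norm_num) hR2]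
  congr 1
  have h1 : (R ^ 2) ^ (-(3 / 2 : ℝ) + 1) = R⁻¹ := by
    rw [show (-(3 / 2 : ℝ) + 1) = -(1 / 2 : ℝ) by norm_num, Real.rpow_neg hR2.le, ← Real.sqrt_eq_rpow,
      Real.sqrt_sq hR.le]
  rw [h1]
  field_simp
  norm_num

/-! ## Joint measurability of the parametric majorants -/

section Measurability

variable {θ : EuclideanSpace ℝ (Fin 3) → ℝ}

/-- The gradient of the Gaussian in closed form, jointly in `(s, z)`: `DG_s(z) = −(G_s(z)/(2s)) ⟪z, ·⟫`. -/
theorem fderiv_heatKernel_eq (s : ℝ) (z : EuclideanSpace ℝ (Fin 3)) :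
    fderiv ℝ (heatKernel s) z = (-(heatKernel s z / (2 * s))) • innerSL ℝ z :=
  (hasFDerivAt_heatKernel s z).fderiv

/-- **Measurability of the near integrand** `(s, y) ↦ ∫ ‖DG_s(x − y)‖ ‖D²θ(x)‖ dx`. [folklore] -/
theorem measurable_nearIntegrand
    (hθ : FunctionSpaces.IsTestFunctionOn (⊤ : TopologicalSpace.Opens (EuclideanSpace ℝ (Fin 3))) θ) :
    Measurable fun p : ℝ × EuclideanSpace ℝ (Fin 3) =>
      ∫ x, ‖fderiv ℝ (heatKernel p.1) (x - p.2)‖ * ‖fderiv ℝ (fderiv ℝ θ) x‖ := by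
  have hθ2 : ContDiff ℝ 2 θ := contDiff_infty.1 hθ.contDiff 2
  have hD2c : Continuous (fderiv ℝ (fderiv ℝ θ)) :=
    (hθ2.fderiv_right (m := 1) le_rfl).continuous_fderiv one_ne_zero
  have hK : Measurable fun q : (ℝ × EuclideanSpace ℝ (Fin 3)) × EuclideanSpace ℝ (Fin 3) =>
      heatKernel q.1.1 (q.2 - q.1.2) :=
    measurable_heatKernel_uncurry.comp (measurable_fst.fst.prodMk (measurable_snd.sub measurable_fst.snd))
  have hF : Measurable fun q : (ℝ × EuclideanSpace ℝ (Fin 3)) × EuclideanSpace ℝ (Fin 3) =>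
      ‖fderiv ℝ (heatKernel q.1.1) (q.2 - q.1.2)‖ * ‖fderiv ℝ (fderiv ℝ θ) q.2‖ := by
    have h1 : (fun q : (ℝ × EuclideanSpace ℝ (Fin 3)) × EuclideanSpace ℝ (Fin 3) =>
        ‖fderiv ℝ (heatKernel q.1.1) (q.2 - q.1.2)‖) =
        fun q => ‖(-(heatKernel q.1.1 (q.2 - q.1.2) / (2 * q.1.1))) • innerSL ℝ (q.2 - q.1.2)‖ := by
      funext q; rw [fderiv_heatKernel_eq]
    have h2 : Measurable fun q : (ℝ × EuclideanSpace ℝ (Fin 3)) × EuclideanSpace ℝ (Fin 3) =>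
        ‖(-(heatKernel q.1.1 (q.2 - q.1.2) / (2 * q.1.1))) • innerSL ℝ (q.2 - q.1.2)‖ := by
      refine Measurable.norm ?_
      refine Measurable.smul ((hK.div (measurable_const.mul measurable_fst.fst)).neg) ?_
      exact ((innerSL ℝ).continuous.comp (continuous_snd.sub (continuous_snd.comp continuous_fst))).measurable
    rw [← h1] at h2
    exact h2.mul ((hD2c.comp continuous_snd).measurable.norm)
  exact (hF.stronglyMeasurable.integral_prod_right').measurable

/-- **Measurability of the far integrand** `(s, y) ↦ ∫ m_s(x − y) |θ(x)| dx`. [folklore] -/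
theorem measurable_farIntegrand
    (hθ : FunctionSpaces.IsTestFunctionOn (⊤ : TopologicalSpace.Opens (EuclideanSpace ℝ (Fin 3))) θ) :
    Measurable fun p : ℝ × EuclideanSpace ℝ (Fin 3) => ∫ x,
      (3 * (heatKernel p.1 (x - p.2) / (4 * p.1 ^ 2)) * ‖x - p.2‖ +
        heatKernel p.1 (x - p.2) / (8 * p.1 ^ 3) * ‖x - p.2‖ ^ 3) * |θ x| := by
  have hK : Measurable fun q : (ℝ × EuclideanSpace ℝ (Fin 3)) × EuclideanSpace ℝ (Fin 3) =>
      heatKernel q.1.1 (q.2 - q.1.2) :=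
    measurable_heatKernel_uncurry.comp (measurable_fst.fst.prodMk (measurable_snd.sub measurable_fst.snd))
  have hz : Measurable fun q : (ℝ × EuclideanSpace ℝ (Fin 3)) × EuclideanSpace ℝ (Fin 3) => ‖q.2 - q.1.2‖ :=
    (measurable_snd.sub measurable_fst.snd).norm
  have hs : Measurable fun q : (ℝ × EuclideanSpace ℝ (Fin 3)) × EuclideanSpace ℝ (Fin 3) => q.1.1 :=
    measurable_fst.fst
  have hθm : Measurable fun q : (ℝ × EuclideanSpace ℝ (Fin 3)) × EuclideanSpace ℝ (Fin 3) => |θ q.2| :=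
    (continuous_abs.comp (hθ.contDiff.continuous.comp continuous_snd)).measurable
  have hF : Measurable fun q : (ℝ × EuclideanSpace ℝ (Fin 3)) × EuclideanSpace ℝ (Fin 3) =>
      (3 * (heatKernel q.1.1 (q.2 - q.1.2) / (4 * q.1.1 ^ 2)) * ‖q.2 - q.1.2‖ +
        heatKernel q.1.1 (q.2 - q.1.2) / (8 * q.1.1 ^ 3) * ‖q.2 - q.1.2‖ ^ 3) * |θ q.2| :=
    ((((hK.div (measurable_const.mul (hs.pow_const 2))).const_mul 3).mul hz).add
      ((hK.div (measurable_const.mul (hs.pow_const 3))).mul (hz.pow_const 3))).mul hθm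
  exact (hF.stronglyMeasurable.integral_prod_right').measurable

end Measurability

/-! ## The caloric datum defect of a test function -/

/-- **`∫ |e^{σΔ}θ − θ| ≤ σ ∫ |Δθ|`** for a test function `θ` and `σ > 0`:
`e^{σΔ}θ(x) − θ(x) = ∫₀^σ e^{rΔ}(Δθ)(x) dr` (tree `KNSSBootstrap.heatExtension_sub_self_eq_integral`), Tonelli,
and the `L¹`-contraction `∫|e^{rΔ}g| ≤ ∫|g|` (`lintegral_enorm_heatExtension_le`). [folklore] -/
theorem lintegral_enorm_heatExtension_sub_self_le {θ : EuclideanSpace ℝ (Fin 3) → ℝ}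
    (hθ : FunctionSpaces.IsTestFunctionOn (⊤ : TopologicalSpace.Opens (EuclideanSpace ℝ (Fin 3))) θ)
    {σ : ℝ} (hσ : 0 < σ) :
    ∫⁻ x, ‖heatExtension θ σ x - θ x‖ₑ ≤ ENNReal.ofReal σ * ∫⁻ x, ‖Δ θ x‖ₑ := by
  have hθ2 : ContDiff ℝ 2 θ := contDiff_infty.1 hθ.contDiff 2
  have hθc : HasCompactSupport θ := hθ.hasCompactSupport
  obtain ⟨C₀, hC₀⟩ := hθ.contDiff.continuous.bounded_above_of_compact_support hθc
  obtain ⟨C₁, hC₁⟩ := (hθ2.continuous_fderiv (by norm_num)).bounded_above_of_compact_support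
    (hθc.fderiv (𝕜 := ℝ))
  obtain ⟨C₂, hC₂⟩ := ((hθ2.fderiv_right (m := 1) le_rfl).continuous_fderiv one_ne_zero).bounded_above_of_compact_support
    ((hθc.fderiv (𝕜 := ℝ)).fderiv (𝕜 := ℝ))
  have hΔc : Continuous (Δ θ) := FluidPDE.continuous_laplacian hθ2
  have hΔs : HasCompactSupport (Δ θ) := hθc.mono' fun z hz => by
    contrapose! hz
    simp [FluidPDE.laplacian_eq_zero_of_notMem_tsupport hz]
  obtain ⟨CΔ, hCΔ⟩ := hΔc.bounded_above_of_compact_support hΔs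
  have hΔi : Integrable (Δ θ) volume := hΔc.integrable_of_hasCompactSupport hΔs
  -- pointwise representation and bound
  have hpt : ∀ x, ‖heatExtension θ σ x - θ x‖ₑ ≤
      ∫⁻ r in Ioc (0 : ℝ) σ, ‖heatExtension (Δ θ) r x‖ₑ := by
    intro x
    rw [KNSSBootstrap.heatExtension_sub_self_eq_integral hθ2 hC₀ hC₁ hC₂ hCΔ hσ x,
      intervalIntegral.integral_of_le hσ.le]
    exact enorm_integral_le_lintegral_enorm _
  -- Tonelli
  have hsm : StronglyMeasurable (fun q : ℝ × EuclideanSpace ℝ (Fin 3) => heatExtension (Δ θ) q.1 q.2) :=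
    stronglyMeasurable_uncurry_heatExtension hΔc.stronglyMeasurable
  have hmeas : AEMeasurable (uncurry fun (x : EuclideanSpace ℝ (Fin 3)) (r : ℝ) => ‖heatExtension (Δ θ) r x‖ₑ)
      ((volume : Measure (EuclideanSpace ℝ (Fin 3))).prod (volume.restrict (Ioc (0 : ℝ) σ))) :=
    ((hsm.measurable.comp measurable_swap).enorm).aemeasurable
  calc ∫⁻ x, ‖heatExtension θ σ x - θ x‖ₑ
      ≤ ∫⁻ x, ∫⁻ r in Ioc (0 : ℝ) σ, ‖heatExtension (Δ θ) r x‖ₑ := lintegral_mono hpt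
    _ = ∫⁻ r in Ioc (0 : ℝ) σ, ∫⁻ x, ‖heatExtension (Δ θ) r x‖ₑ := lintegral_lintegral_swap hmeas
    _ ≤ ∫⁻ r in Ioc (0 : ℝ) σ, ∫⁻ x, ‖Δ θ x‖ₑ := by
        refine lintegral_mono_ae ?_
        filter_upwards [ae_restrict_mem measurableSet_Ioc] with r hr
        exact lintegral_enorm_heatExtension_le hΔi hr.1
    _ = ENNReal.ofReal σ * ∫⁻ x, ‖Δ θ x‖ₑ := by
        rw [setLIntegral_const, Real.volume_Ioc, sub_zero, mul_comm]

end Summit.NavierStokesRegularity.NavierStokesRegularity.Theorems.PoloidalWindowDoorPoloidalWindowRigidityBumpRates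

end
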